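import Literature.MathematicalPhysics.QuantumFieldTheory.ONArchipelagoSingletTail
import Literature.MathematicalPhysics.QuantumFieldTheory.ONArchipelagoTwoSign
import Literature.MathematicalPhysics.QuantumFieldTheory.ONArchipelagoVectorTail
import HarnessLib

/-!
# The `O(N)` archipelago point-certificate schema with every tail in closed form

Eighth and closing file of the archipelago rung: the KERNEL CONTRACT of an `O(N)` archipelago
points certificate.  A point 7-vector `ofPoints z z̄ w` (nodes in the open square, `z̄_k ≤ z_k`, a
dominating apex `a`), a box `Q ⊆ [φ_lo,φ_hi] × [s_lo,s_hi]`, gaps `A = (Δ_S^*, Δ_V^*, Δ_T^*)`, a twist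
margin `τ` and the split points `1 < E₀ ≤ E_T` exclude `Q` (`BoxExcluded N A Q`: no unitary `O(N)` CFT
with `(Δ_φ, Δ_s) ∈ Q` and the assumed gaps) as soon as

* (I) the identity number is `> 0` (three corner numbers, `identityTerm_ofPoints_pos_of_cornerBounds`);
* the LIGHT rows below `E₀` hold — `T` scalars from `Δ_T^*`, even `T` spins, odd `A` spins, `V` scalars
  from `Δ_V^*`, `V` spins (either parity), `S` scalars from `Δ_S^*`, even `S` spins — finitely many
  `(ℓ, Δ-cell)` obligations, HYPOTHESES here (served by the head-cell files of the `σ–ε` and vector rungs);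
* the external `2×2` form is PSD on `Q` (hypothesis; `extPositive_of_separate` or a direct check);
* the four TAILS `Δ ≥ E₀` hold by closed-form rules between the certificate's own numbers:
  `T` and `A` — a `cornerBound₂` box table on `E ∈ [E₀,E_T)`, `j + τ ≤ E` and ONE `apexRest₂` inequality
  each (`tail_tensorPositive_of_table_and_apex`, `tail_antiPositive_of_table_and_apex`);
  `V` — (M_V) boxes and (T_V) (`tail_vectorPositive_of_boxes_and_apex`);
  `S` — (M) four-number boxes and (T) three apex numbers (`tail_singletPositive_of_boxes_and_apex`).

`boxExcluded_of_archipelagoPointRules₂` assembles these into `ArchipelagoObligations` and applies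
`ArchipelagoObligations.boxExcluded`.  Every infinite family of the source's semidefinite program
(`KosPolandSimmonsDuffinVichi2015` §2.2, bullet list) is thereby reduced to finitely many decidable
inequalities; the finitely many light rows are what a certificate's interval tables discharge.
No table, no number, no `sorry`.

Sources: arXiv:1504.07997 §2.2 (`KosPolandSimmonsDuffinVichi2015`); M. Hogervorst, S. Rychkov,
Phys. Rev. D 87 (2013) 106004, §3 (`HogervorstRychkov2013`); D. Pappadopulo, S. Rychkov, J. Espin,
R. Rattazzi, Phys. Rev. D 86 (2012) 105043, §5 (`PappadopuloRychkovEspinRattazzi2012`).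
-/

noncomputable section

namespace Literature.MathematicalPhysics.QuantumFieldTheory.ONArchipelagoSystem

open Finset Set Filter Topology
open ConformalBootstrap3D (IsConformalBlock3D unitarityBound3D crossF pointFunctional zMono cornerBound₂
  termCornerBound apexRest apexRest₂ oddDomEval)

namespace ArchipelagoFunctional

/-- **The archipelago point-certificate schema, every tail closed-form.**  Light rows below `E₀` and the
external form as hypotheses; identity by corner numbers; `T`/`A` tails by a two-sign box table and one
apex inequality each; `V` tail by (M_V)/(T_V); `S` tail by (M)/(T).  Conclusion: `BoxExcluded N A Q`.
[cite: KosPolandSimmonsDuffinVichi2015, §2.2 (functional conditions)] -/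
theorem boxExcluded_of_archipelagoPointRules₂ {N n : ℕ} {z zb : Fin n → ℝ} {w : Fin 7 → Fin n → ℝ}
    (hz : ∀ k, z k ∈ Ioo (0 : ℝ) 1) (hzb : ∀ k, zb k ∈ Ioo (0 : ℝ) 1) (hord : ∀ k, zb k ≤ z k)
    (a : Fin n) (qd qr : Fin n → ℝ) (hqd : ∀ k, 0 < qd k ∧ qd k ≤ 1)
    (hqr : ∀ k, 0 < qr k ∧ qr k ≤ 1)
    (hdomd : ∀ k, z k * zb k ≤ qd k ^ 2 * (z a * zb a) ∧ z k ≤ qd k * z a)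
    (hdomr : ∀ k, (1 - z k) * (1 - zb k) ≤ qr k ^ 2 * (z a * zb a) ∧ 1 - zb k ≤ qr k * z a)
    {A : ArchipelagoGaps} {Q : Set (ℝ × ℝ)} {φlo φhi slo shi E₀ ET τ : ℝ}
    (hQ : ∀ p ∈ Q, (φlo ≤ p.1 ∧ p.1 ≤ φhi) ∧ (slo ≤ p.2 ∧ p.2 ≤ shi))
    (hτ1 : τ ≤ 1) (hτ0 : τ ≤ E₀) (hE1 : 1 < E₀)
    -- (I)
    (hI : 0 < cornerBound₂ (w 1 + w 2) (w 1 - w 2) z zb 0 0 0 φlo φhi +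
      termCornerBound (w 3) z zb 0 0 0 slo shi +
      cornerBound₂ (w 5 + w 6) (w 5 - w 6) z zb 0 0 0 ((φlo + slo) / 2) ((φhi + shi) / 2))
    -- (X)
    (hext : ∀ p ∈ Q, (ofPoints z zb w).ExtPositive p.1 p.2)
    -- light rows below E₀
    (hT3 : ∀ p ∈ Q, ∀ Δ : ℝ, A.ΔTstar ≤ Δ → 1 / 2 ≤ Δ → Δ < E₀ →
      (ofPoints z zb w).TensorPositive N p.1 Δ 0)
    (hT4 : ∀ p ∈ Q, ∀ ℓ : ℕ, Even ℓ → ℓ ≠ 0 → ∀ Δ : ℝ, (ℓ : ℝ) + 1 ≤ Δ → Δ < E₀ →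
      (ofPoints z zb w).TensorPositive N p.1 Δ ℓ)
    (hA4 : ∀ p ∈ Q, ∀ ℓ : ℕ, Odd ℓ → ∀ Δ : ℝ, (ℓ : ℝ) + 1 ≤ Δ → Δ < E₀ →
      (ofPoints z zb w).AntiPositive p.1 Δ ℓ)
    (hV3 : ∀ p ∈ Q, ∀ Δ : ℝ, A.ΔVstar ≤ Δ → 1 / 2 ≤ Δ → Δ < E₀ →
      (ofPoints z zb w).VectorPositive p.1 p.2 Δ 0)
    (hV4 : ∀ p ∈ Q, ∀ ℓ : ℕ, ℓ ≠ 0 → ∀ Δ : ℝ, (ℓ : ℝ) + 1 ≤ Δ → Δ < E₀ →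
      (ofPoints z zb w).VectorPositive p.1 p.2 Δ ℓ)
    (hS3 : ∀ p ∈ Q, ∀ Δ : ℝ, A.ΔSstar ≤ Δ → 1 / 2 ≤ Δ → Δ < E₀ →
      (ofPoints z zb w).SingletPositive p.1 p.2 Δ 0)
    (hS4 : ∀ p ∈ Q, ∀ ℓ : ℕ, Even ℓ → ℓ ≠ 0 → ∀ Δ : ℝ, (ℓ : ℝ) + 1 ≤ Δ → Δ < E₀ →
      (ofPoints z zb w).SingletPositive p.1 p.2 Δ ℓ)
    -- T tail: two-sign box table + apex
    (haT : 0 ≤ tensorMinusWeights w N a + tensorPlusWeights w N a) (eT : ℕ → ℕ → ℝ) (MT : ℕ → ℕ)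
    (heT : ∀ j : ℕ, (j : ℝ) + τ < ET → eT j 0 ≤ max E₀ ((j : ℝ) + τ) ∧ ET ≤ eT j (MT j))
    (hboxT : ∀ j : ℕ, (j : ℝ) + τ < ET → ∀ m < MT j,
      0 ≤ cornerBound₂ (tensorMinusWeights w N + tensorPlusWeights w N)
        (tensorMinusWeights w N - tensorPlusWeights w N) z zb j (eT j m) (eT j (m + 1)) φlo φhi)
    (hBT : apexRest₂ (tensorMinusWeights w N + tensorPlusWeights w N)
        (tensorMinusWeights w N - tensorPlusWeights w N) z zb a qd qr φlo ET ≤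
      (tensorMinusWeights w N a + tensorPlusWeights w N a) * ((1 - z a) * (1 - zb a)) ^ φhi)
    -- A tail: two-sign box table + apex
    (haA : 0 ≤ antiMinusWeights w a + antiPlusWeights w a) (eA : ℕ → ℕ → ℝ) (MA : ℕ → ℕ)
    (heA : ∀ j : ℕ, (j : ℝ) + τ < ET → eA j 0 ≤ max E₀ ((j : ℝ) + τ) ∧ ET ≤ eA j (MA j))
    (hboxA : ∀ j : ℕ, (j : ℝ) + τ < ET → ∀ m < MA j,
      0 ≤ cornerBound₂ (antiMinusWeights w + antiPlusWeights w)
        (antiMinusWeights w - antiPlusWeights w) z zb j (eA j m) (eA j (m + 1)) φlo φhi)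
    (hBA : apexRest₂ (antiMinusWeights w + antiPlusWeights w) (antiMinusWeights w - antiPlusWeights w)
        z zb a qd qr φlo ET ≤
      (antiMinusWeights w a + antiPlusWeights w a) * ((1 - z a) * (1 - zb a)) ^ φhi)
    -- V tail: (M_V) boxes + (T_V)
    (hMV : ∀ (j : ℕ) (E : ℝ), E₀ ≤ E → E < ET → (j : ℝ) + τ ≤ E → ∀ p ∈ Q,
      0 ≤ oddDomEval z zb (oddWeights w) p.1 (zMono E j))
    (hcV : 0 ≤ w 5 a - w 6 a - |w 4 a|)
    (hTV : apexRest (w 5) z zb a qd qr φlo ET + apexRest (w 6) z zb a qd qr φlo ET +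
        apexRest (fun k => |w 4 k|) z zb a qd qr φlo ET ≤
      (w 5 a - w 6 a - |w 4 a|) * ((1 - z a) * (1 - zb a)) ^ φhi)
    -- S tail: (M) boxes + (T) apex numbers
    (hMS : ∀ (j : ℕ) (E : ℝ), E₀ ≤ E → E < ET → (j : ℝ) + τ ≤ E → ∀ p ∈ Q,
      ∀ x y : ℝ, 0 ≤ singletTermForm z zb w p.1 p.2 E j x y)
    (h12 : 0 ≤ w 1 a + w 2 a) (h3 : 0 ≤ w 3 a)
    (hX : 0 ≤ (w 1 a + w 2 a) * ((1 - z a) * (1 - zb a)) ^ φhi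
      - apexRest (w 1) z zb a qd qr φlo ET - apexRest (w 2) z zb a qd qr φlo ET)
    (hY : 0 ≤ w 3 a * ((1 - z a) * (1 - zb a)) ^ shi - apexRest (w 3) z zb a qd qr slo ET)
    (hZ : (|w 5 a + w 6 a| * ((1 - z a) * (1 - zb a)) ^ ((φlo + slo) / 2)
            + apexRest (w 5) z zb a qd qr ((φlo + slo) / 2) ET
            + apexRest (w 6) z zb a qd qr ((φlo + slo) / 2) ET) ^ 2 ≤
        4 * ((w 1 a + w 2 a) * ((1 - z a) * (1 - zb a)) ^ φhi
              - apexRest (w 1) z zb a qd qr φlo ET - apexRest (w 2) z zb a qd qr φlo ET) *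
          (w 3 a * ((1 - z a) * (1 - zb a)) ^ shi - apexRest (w 3) z zb a qd qr slo ET)) :
    BoxExcluded N A Q := by
  have hQ1 : ∀ p ∈ Q, φlo ≤ p.1 ∧ p.1 ≤ φhi := fun p hp => (hQ p hp).1
  have hTt := tail_tensorPositive_of_table_and_apex z zb w N hz hzb hord a haT qd qr hqd hqr hdomd hdomr
    hQ1 hτ1 hτ0 eT MT heT hboxT hBT
  have hAt := tail_antiPositive_of_table_and_apex z zb w hz hzb hord a haA qd qr hqd hqr hdomd hdomr
    hQ1 hτ1 hτ0 eA MA heA hboxA hBA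
  have hVt := tail_vectorPositive_of_boxes_and_apex z zb w hz hzb hord a qd qr hqd hqr hdomd hdomr hQ
    hτ1 hτ0 hE1 hMV hcV hTV
  have hSt := tail_singletPositive_of_boxes_and_apex z zb w hz hzb hord a qd qr hqd hqr hdomd hdomr hQ
    hτ1 hτ0 hMS h12 h3 hX hY hZ
  have hO : ArchipelagoObligations (ofPoints z zb w) N A Q E₀ :=
    { identity_pos := identityTerm_ofPoints_pos_of_cornerBounds z zb w hz hzb hQ hI
      ext := hext
      scalar_T := hT3
      spinning_T := hT4
      tail_T := fun p hp ℓ _ Δ hb h0 => hTt p hp ℓ Δ hb h0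
      spinning_A := hA4
      tail_A := fun p hp ℓ _ Δ hb h0 => hAt p hp ℓ Δ hb h0
      scalar_V := hV3
      spinning_V := hV4
      tail_V := hVt
      scalar_S := hS3
      spinning_S := hS4
      tail_S := fun p hp ℓ _ Δ hb h0 => hSt p hp ℓ Δ hb h0 }
  exact hO.boxExcluded hz hzb

end ArchipelagoFunctional

end Literature.MathematicalPhysics.QuantumFieldTheory.ONArchipelagoSystem
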